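import Mathlib

/-!
# Sketch — crux-ideate stmt-QuantumFields-8646 (HypercubicLimit), ideator 3, round 1

First lemmas of the idea cards (they need only elaborate; the first two are provable now from
`Matrix.PosSemidef.fromBlocks₂₂` / `Matrix.det_fromBlocks₂₂`).
-/

namespace Summit.QuantumFields.YangMills.Cruxes.HypercubicLimit.Ideator3

open Matrix
open scoped ComplexOrder

/-- **Feshbach–Schur ground-energy criterion (finite-dimensional form).**
For a Hermitian block operator `H = [[A, B], [Bᴴ, D]]` (slow block `A` = vacuum-valley / zero-momentum
modes, fast block `D` = non-zero-momentum modes) and a real level `E` strictly below the fast block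
(`D − E·1` positive definite), `H − E·1 ⪰ 0` iff the Schur complement (Feshbach map)
`F(E) := A − E·1 − B (D − E·1)⁻¹ Bᴴ` is `⪰ 0`.  Hence the ground energy of `H` (in any symmetry
sector, e.g. an 't Hooft electric-flux sector of the twisted torus transfer matrix) is
`sup {E below the fast block : F(E) ⪰ 0}` — an EXACT finite-dimensional characterisation, the error
entering only through computable bounds on `(D − E·1)⁻¹`. Card `feshbach-vacuum-valley-flux-certificate`,
first lemma. Provable now (`Matrix.PosSemidef.fromBlocks₂₂` applied to the shifted blocks). -/
def FeshbachGroundCriterion : Prop :=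
  ∀ (m n : Type) [Fintype m] [Fintype n] [DecidableEq m] [DecidableEq n]
    (A : Matrix m m ℂ) (B : Matrix m n ℂ) (D : Matrix n n ℂ) (E : ℝ),
    A.IsHermitian → D.IsHermitian → (D - (E : ℂ) • (1 : Matrix n n ℂ)).PosDef →
      ((Matrix.fromBlocks A B Bᴴ D - (E : ℂ) • (1 : Matrix (m ⊕ n) (m ⊕ n) ℂ)).PosSemidef ↔
        (A - (E : ℂ) • (1 : Matrix m m ℂ)
          - B * (D - (E : ℂ) • (1 : Matrix n n ℂ))⁻¹ * Bᴴ).PosSemidef)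

/-- **Feshbach isospectrality (determinant form).** Same setting: for `E` with `D − E·1` invertible,
`E` is an eigenvalue of `H` iff `det F(E) = 0`. Provable now from `Matrix.det_fromBlocks₂₂`. -/
def FeshbachIsospectral : Prop :=
  ∀ (m n : Type) [Fintype m] [Fintype n] [DecidableEq m] [DecidableEq n]
    (A : Matrix m m ℂ) (B : Matrix m n ℂ) (D : Matrix n n ℂ) (E : ℂ),
    IsUnit (D - E • (1 : Matrix n n ℂ)).det →
      ((Matrix.fromBlocks A B Bᴴ D - E • (1 : Matrix (m ⊕ n) (m ⊕ n) ℂ)).det = 0 ↔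
        (A - E • (1 : Matrix m m ℂ) - B * (D - E • (1 : Matrix n n ℂ))⁻¹ * Bᴴ).det = 0)

/-- **Twist ratio from electric-flux energies (the certificate's arithmetic, `SU(2)`, one twisted
plane).** With sector weights `w e = exp (−Lₜ · Eₑ)` over `e ∈ (ℤ/2)³` ('t Hooft electric fluxes on
the spatial 3-torus) and the separate-strings law `Eₑ = κ · |e|₁ / L`-type lower bound, the twisted/
untwisted ratio `Z(m)/Z(1) = (Σ_{e₃ = 0} w e − Σ_{e₃ = 1} w e) / Σ_e w e` is at least `1 − ε` as soon
as every non-zero flux sector costs `Eₑ ≥ log (8/ε) / Lₜ`. Stated abstractly for any non-negative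
weights with `w 0 = 1`; elementary (provable now). -/
def TwistRatioFromFluxGap : Prop :=
  ∀ (w : (Fin 3 → ZMod 2) → ℝ) (ε : ℝ), 0 < ε → ε ≤ 1 → (∀ e, 0 ≤ w e) → w 0 = 1 →
    (∀ e, e ≠ 0 → w e ≤ ε / 8) →
      1 - ε ≤ ((∑ e : Fin 3 → ZMod 2, (if e 2 = 0 then w e else -w e)) /
        (∑ e : Fin 3 → ZMod 2, w e))

end Summit.QuantumFields.YangMills.Cruxes.HypercubicLimit.Ideator3
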